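import Summits.FinalStateConjecture.FinalStateConjecture.Theorems.EIHFluxBalanceInertialRecessionRechartLagBackground

/-!
# Route EIHFluxBalance — `InertialRecession`, re-charting: one hole's FINAL (boosted, lagged) chart —
# pointwise transport of the rest-frame dictionaries and of the certified reach

Helper file for the crux `stmt-FinalStateConjecture-10166`
(`Summit.FinalStateConjecture.FinalStateConjecture.Theses.EIHFluxBalance.InertialRecession`),
stub `stub_rechart` (the transfer P2 of line `sublinear-is-free-clean-window-charges`), part G2.

For the final background `Kf = boostedKerrBackground Λ (s₀ • Λe₀) M a` of a hole (final boost `Λ`,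
lag `s₀`) and its chart `ψ y = Φ(A(Λ⁻¹ y))` (`A` the re-charting map of `clockChart_package`,
`Ψ_A z = Φ(A z)` the rest chart), with model point `z = Λ⁻¹y`, time `z⁰ − s₀`, radius `r_a(z)`
(…RechartLagBackground):
* `isOpenEmbedding_restChart`, `isOpenEmbedding_finalChart` — `Ψ_A` and `ψ` are open embeddings;
* `cov_transport` — a rest preimage `z` of a lab point (`A z = x`, exact radius, clock estimate
  `|z⁰ − θ| ≤ b`) gives a model point `y = Λz` of `Kf` with `ψ y = Φ x`, the same radius and
  `|t*(y) − (θ − s₀)| ≤ b` (the hypothesis `hcov` of …RechartTransfer3);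
* `lab_transport` — `Φ x = ψ y` with both points late forces `x = A(Λ⁻¹y)` (the hypothesis `hlab`);
* `stat_transport` — the rest-frame certified reach at chart time `τ₁ + s₀` is the reach of `ψ` at `τ₁`
  for the shifted profile `R(· + s₀)` (the hypothesis `hstat`);
* `finalChart_late` — every chart point is a late point of the painted exterior.
[folklore]
-/

noncomputable section

set_option linter.dupNamespace false

open Set Filter Topology Function TopologicalSpace Literature.Geometry.Lorentzian
open Summit.FinalStateConjecture.FinalStateConjecture.Theorems.SublinearIsFree.Rechart
open scoped Manifold ContDiff ENNReal

namespace Summit.FinalStateConjecture.FinalStateConjecture.Theorems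

section Hole

variable {𝓢 : Spacetime 4} (Λ : lorentzGroup) (s₀ M a : ℝ) (U : Opens E4) (Φ : U → 𝓢.carrier)
  (A : E4 → E4) (hAU : ∀ z ∈ boostedKerrExterior 1 0 M a, A z ∈ U)
  (ψ : boostedKerrExterior Λ (s₀ • (Λ : E4 ≃L[ℝ] E4) (E4.basisVector 0)) M a → 𝓢.carrier)
  (hψ : ∀ y, ψ y = Φ ⟨A ((Λ : E4 ≃L[ℝ] E4).symm y.1), hAU _ (symm_mem_rest_of_mem_lag Λ s₀ M a y.2)⟩)

/-- **The rest chart `Ψ_A = Φ ∘ A` is an open embedding** when `A` is an open embedding into the late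
region on which `Φ` is one. [folklore] -/
theorem isOpenEmbedding_restChart {τ₀ : ℝ}
    (hemb : IsOpenEmbedding (({x : U | τ₀ < x.1 0} : Set U).restrict Φ))
    (hA : IsOpenEmbedding A) (hlate : ∀ z, τ₀ < A z 0) :
    IsOpenEmbedding (fun z : boostedKerrExterior 1 0 M a ↦ Φ ⟨A z.1, hAU z.1 z.2⟩) := by
  let j : boostedKerrExterior 1 0 M a → ({x : U | τ₀ < x.1 0} : Set U) :=
    fun z ↦ ⟨⟨A z.1, hAU z.1 z.2⟩, hlate z.1⟩
  have hc0 : Continuous fun y : E4 ↦ y 0 := PiLp.continuous_apply 2 _ 0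
  have hLo : IsOpen ({x : U | τ₀ < x.1 0} : Set U) :=
    isOpen_lt continuous_const (hc0.comp continuous_subtype_val)
  have hg0 : IsOpenEmbedding (fun y : ({x : U | τ₀ < x.1 0} : Set U) ↦ (y.1.1 : E4)) :=
    U.isOpen.isOpenEmbedding_subtypeVal.comp hLo.isOpenEmbedding_subtypeVal
  have hg1 : IsOpenEmbedding (fun z : boostedKerrExterior 1 0 M a ↦ A z.1) :=
    hA.comp (boostedKerrExterior 1 0 M a).isOpen.isOpenEmbedding_subtypeVal
  have hj : IsOpenEmbedding j := IsOpenEmbedding.of_comp j hg0 hg1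
  exact hemb.comp hj

include hψ in
/-- **The final chart is an open embedding.** [folklore] -/
theorem isOpenEmbedding_finalChart {τ₀ : ℝ}
    (hemb : IsOpenEmbedding (({x : U | τ₀ < x.1 0} : Set U).restrict Φ))
    (hA : IsOpenEmbedding A) (hlate : ∀ z, τ₀ < A z 0) : IsOpenEmbedding ψ :=
  isOpenEmbedding_lagChart Λ s₀ M a (fun z : boostedKerrExterior 1 0 M a ↦ Φ ⟨A z.1, hAU z.1 z.2⟩) ψ
    (isOpenEmbedding_restChart M a U Φ A hAU hemb hA hlate) hψ

include hψ in
/-- **Every final-chart point is a late point of the painted exterior** (transport of the package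
clauses "late" and "inside the painted exterior"). [folklore] -/
theorem finalChart_late {τ₀ : ℝ} {P : E4 → Prop} (hlate : ∀ z, τ₀ < A z 0)
    (hP : ∀ z ∈ boostedKerrExterior 1 0 M a, P (A z))
    (y : boostedKerrExterior Λ (s₀ • (Λ : E4 ≃L[ℝ] E4) (E4.basisVector 0)) M a) :
    ∃ x : U, ψ y = Φ x ∧ τ₀ < x.1 0 ∧ P x.1 :=
  ⟨⟨A ((Λ : E4 ≃L[ℝ] E4).symm y.1), hAU _ (symm_mem_rest_of_mem_lag Λ s₀ M a y.2)⟩, hψ y, hlate _,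
    hP _ (symm_mem_rest_of_mem_lag Λ s₀ M a y.2)⟩

include hψ in
/-- **Transport of the coverage dictionary** to the final chart. [folklore] -/
theorem cov_transport {x : U} {z : E4} (hAz : A z = x.1) (hz : z ∈ boostedKerrExterior 1 0 M a)
    {θx b : ℝ} (htime : |z 0 - θx| ≤ b) :
    ∃ y : boostedKerrExterior Λ (s₀ • (Λ : E4 ≃L[ℝ] E4) (E4.basisVector 0)) M a, ψ y = Φ x ∧
      (boostedKerrBackground Λ (s₀ • (Λ : E4 ≃L[ℝ] E4) (E4.basisVector 0)) M a).radius y.1 =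
        Kerr.radius a z ∧
      |(boostedKerrBackground Λ (s₀ • (Λ : E4 ≃L[ℝ] E4) (E4.basisVector 0)) M a).time y.1 - (θx - s₀)| ≤
        b := by
  refine ⟨⟨(Λ : E4 ≃L[ℝ] E4) z, apply_mem_lag_of_mem_rest Λ s₀ M a hz⟩, ?_, ?_, ?_⟩
  · rw [hψ]
    congr 1
    refine Subtype.ext ?_
    show A ((Λ : E4 ≃L[ℝ] E4).symm ((Λ : E4 ≃L[ℝ] E4) z)) = x.1
    rw [ContinuousLinearEquiv.symm_apply_apply, hAz]
  · rw [lag_radius, ContinuousLinearEquiv.symm_apply_apply]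
  · rw [lag_time, ContinuousLinearEquiv.symm_apply_apply, show (z 0 - s₀) - (θx - s₀) = z 0 - θx by ring]
    exact htime

include hψ in
/-- **Transport of the lab dictionary**: `Φ x = ψ y` with both points late gives `x = A(Λ⁻¹y)`, so any
rest-frame statement about `A z` with `‖z̃‖`-bounded offset applies; here: the painted radius of `x`
equals the model radius of `y` once the rest dictionary says so for `z = Λ⁻¹y`. [folklore] -/
theorem lab_transport {τ₀ : ℝ} (hinj : ∀ x x' : U, τ₀ < x.1 0 → τ₀ < x'.1 0 → Φ x = Φ x' → x = x')
    (hlate : ∀ z, τ₀ < A z 0) {rp : U → ℝ} {K tK : ℝ}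
    (hdict : ∀ z : E4, tK ≤ A z 0 → ‖E4.spatial z‖ ≤ K → ∀ h : A z ∈ U, rp ⟨A z, h⟩ = Kerr.radius a z)
    (y : boostedKerrExterior Λ (s₀ • (Λ : E4 ≃L[ℝ] E4) (E4.basisVector 0)) M a) (x : U)
    (hxy : Φ x = ψ y) (hx : τ₀ < x.1 0) (hxt : tK ≤ x.1 0)
    (hK : ‖E4.spatial ((Λ : E4 ≃L[ℝ] E4).symm y.1)‖ ≤ K) :
    rp x = (boostedKerrBackground Λ (s₀ • (Λ : E4 ≃L[ℝ] E4) (E4.basisVector 0)) M a).radius y.1 := by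
  set z : E4 := (Λ : E4 ≃L[ℝ] E4).symm y.1 with hz
  have hzU : A z ∈ U := hAU _ (symm_mem_rest_of_mem_lag Λ s₀ M a y.2)
  have hxA : x = ⟨A z, hzU⟩ := hinj x ⟨A z, hzU⟩ hx (hlate z) (hxy.trans (hψ y))
  have hxt' : tK ≤ A z 0 := by rw [hxA] at hxt; exact hxt
  rw [lag_radius, hxA]
  exact hdict z hxt' hK hzU

include hψ in
/-- **Transport of the certified reach** to the final chart: if the rest chart reaches the rest slab
at chart time `τ₁ + s₀` from `{S' ≤ z⁰ ≤ τ₁ + s₀, r₊ + δ ≤ r ≤ R(z⁰)}`, then `ψ` reaches its slab at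
`τ₁` from `{S' − s₀ ≤ t* ≤ τ₁, r₊ + δ ≤ r ≤ R(t* + s₀)}`. [folklore] -/
theorem stat_transport (R : ℝ → ℝ) {S' τ₁ δ : ℝ}
    (hrest : ∀ z : boostedKerrExterior 1 0 M a, S' ≤ z.1 0 → z.1 0 ≤ τ₁ + s₀ →
      Kerr.rPlus M a + δ ≤ Kerr.radius a z.1 → Kerr.radius a z.1 ≤ R (z.1 0) →
      Φ ⟨A z.1, hAU z.1 z.2⟩ ∈ 𝓢.metric.causalPast 𝓢.timeOrientation
        ((fun z : boostedKerrExterior 1 0 M a ↦ Φ ⟨A z.1, hAU z.1 z.2⟩) ''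
          (boostedKerrBackground 1 0 M a).truncTimeSlab (R (τ₁ + s₀)) (τ₁ + s₀)))
    (y : boostedKerrExterior Λ (s₀ • (Λ : E4 ≃L[ℝ] E4) (E4.basisVector 0)) M a)
    (hyS : S' - s₀ ≤ (boostedKerrBackground Λ (s₀ • (Λ : E4 ≃L[ℝ] E4) (E4.basisVector 0)) M a).time y.1)
    (hyt : (boostedKerrBackground Λ (s₀ • (Λ : E4 ≃L[ℝ] E4) (E4.basisVector 0)) M a).time y.1 ≤ τ₁)
    (hr1 : Kerr.rPlus M a + δ ≤
      (boostedKerrBackground Λ (s₀ • (Λ : E4 ≃L[ℝ] E4) (E4.basisVector 0)) M a).radius y.1)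
    (hr2 : (boostedKerrBackground Λ (s₀ • (Λ : E4 ≃L[ℝ] E4) (E4.basisVector 0)) M a).radius y.1 ≤
      R ((boostedKerrBackground Λ (s₀ • (Λ : E4 ≃L[ℝ] E4) (E4.basisVector 0)) M a).time y.1 + s₀)) :
    ψ y ∈ 𝓢.metric.causalPast 𝓢.timeOrientation
      (ψ '' (boostedKerrBackground Λ (s₀ • (Λ : E4 ≃L[ℝ] E4) (E4.basisVector 0)) M a).truncTimeSlab
        (R (τ₁ + s₀)) τ₁) := by
  rw [(image_lagChart_slabs Λ s₀ M a (fun z : boostedKerrExterior 1 0 M a ↦ Φ ⟨A z.1, hAU z.1 z.2⟩) ψ hψ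
    (R (τ₁ + s₀)) τ₁ τ₁ R).1, hψ y]
  set z : boostedKerrExterior 1 0 M a :=
    ⟨(Λ : E4 ≃L[ℝ] E4).symm y.1, symm_mem_rest_of_mem_lag Λ s₀ M a y.2⟩ with hz
  rw [lag_time] at hyS hyt hr2
  rw [lag_radius] at hr1 hr2
  have h := hrest z (by show S' ≤ ((Λ : E4 ≃L[ℝ] E4).symm y.1) 0; linarith)
    (by show ((Λ : E4 ≃L[ℝ] E4).symm y.1) 0 ≤ τ₁ + s₀; linarith) hr1
    (by rw [sub_add_cancel] at hr2; exact hr2)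
  exact h

end Hole

/-- Registered one-line form (stub `max_lt_of_lt_of_pos_rechart` of the crux item): the exterior
membership arithmetic `r₊ < r`, `0 < r₊` ⇒ `max r₊ 0 < r`. [folklore] -/
theorem max_lt_of_lt_of_pos_rechart : ∀ {rp r : ℝ}, rp < r → 0 < rp → max rp 0 < r :=
  fun h h0 ↦ max_lt h (h0.trans h)

end Summit.FinalStateConjecture.FinalStateConjecture.Theorems
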